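import Mathlib
import Summits.ResolutionOfSingularities.ResolutionOfSingularities.Theorems.WildQuotientsWildQuotientResolutionJordanThreeChartsA

/-!
# Rung V3 (one blow-up model): the chart `D₊(x_a³x_b t)` (B2a) of `Bl_{K₃} 𝔸ⁿ` is an affine space

(crux stmt-ResolutionOfSingularities-15640 `WildQuotients.WildQuotientResolution`, line `Sketch`,
sector `|G| = p`; rung V3 of `L/w45c/CHAIN.md` v4, ONE-BLOW-UP design of record (lead-1 RULING
2026-08-27T01:07:58Z); part (b) of stub-4's split, chart `j = 1` (B2a); chart `j = 0` (A) and
the generic criteria are in `…JordanThreeChartsA`. [OURS · L1 W4.5c] — NOT a statement of any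
manuscript; replaces the role of no printed item.)

`K₃ = (x_a⁴, x_a³x_b, x_a²x_b³, x_a x_b⁴, x_b⁶)`; chart B2a = `D₊(x_a³x_b t)`:
`k[x][K₃/x_a³x_b] = k[u = x_a/x_b, y = x_b³/x_a², rest]` (`x_a = u³y`, `x_b = u²y`; the toric
chart of the cone `⟨(3,2),(1,1)⟩` of the fan refining the quadrant by `(1,1), (2,1), (3,2)`).
-/

-- single-problem summit: the doubled namespace component `ResolutionOfSingularities` is forced
set_option linter.dupNamespace false

noncomputable section

open MvPolynomial IsLocalization
open Literature.AlgebraicGeometry.Resolution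

namespace Summit.ResolutionOfSingularities.ResolutionOfSingularities.Theorems.WildQuotientResolution.JordanThree

universe u

section Charts

variable (k : Type) [Field k] (n : ℕ) (a b : Fin n)

/-! ### Chart B2a = `D₊(x_a³x_b t)`: coordinates `u = x_a/x_b`, `y = x_b³/x_a²` -/

/-- **Chart B2a of `Bl_{K₃} 𝔸ⁿ` is regular**: the chart ring `(R[K₃t])_{(x_a³x_b t)}` is the
polynomial ring `k[u, y, rest]`, `u = x_a⁴/(x_a³x_b) = x_a/x_b`, `y = x_a x_b⁴/(x_a³x_b) = x_b³/x_a²`,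
with `x_a = u³y`, `x_b = u²y` (the remaining fractions are `x_a²x_b³/(x_a³x_b) = uy`,
`x_b⁶/(x_a³x_b) = uy²`); in particular a regular ring. [folklore; toric chart of the cone
`⟨(3,2),(1,1)⟩`] -/
theorem isRegularRing_chartRing_k3_one (hab : a ≠ b) :
    IsRegularRing (chartRing
      (![X a ^ 4, X a ^ 3 * X b, X a ^ 2 * X b ^ 3, X a * X b ^ 4, X b ^ 6] :
        Fin 5 → MvPolynomial (Fin n) k) 1) := by
  classical
  -- notation
  let c : Fin 5 → MvPolynomial (Fin n) k :=
    ![X a ^ 4, X a ^ 3 * X b, X a ^ 2 * X b ^ 3, X a * X b ^ 4, X b ^ 6]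
  let L := Localization.Away (c 1)
  let am : MvPolynomial (Fin n) k →+* L := algebraMap _ L
  let ι : L := Away.invSelf (c 1)
  have hinv : am (X a) ^ 3 * am (X b) * ι = 1 := by
    rw [← map_pow, ← map_mul]
    exact Away.mul_invSelf (S := L) (c 1)
  have hba : b ≠ a := fun h => hab h.symm
  haveI : IsRegularRing (MvPolynomial (Fin n) k) := MvPolynomial.isRegularRing_of_isRegularRing k
  -- the chart map `x_a ↦ u = x_a⁴/(x_a³x_b)`, `x_b ↦ y = x_a x_b⁴/(x_a³x_b)`
  let v : Fin n → L := fun i =>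
    if i = a then am (X a ^ 4) * ι else if i = b then am (X a * X b ^ 4) * ι else am (X i)
  let φ : MvPolynomial (Fin n) k →ₐ[k] L := aeval v
  have hφa : φ (X a) = am (X a ^ 4) * ι := by simp [φ, v]
  have hφb : φ (X b) = am (X a * X b ^ 4) * ι := by simp [φ, v, hba]
  have hφi : ∀ i, i ≠ a → i ≠ b → φ (X i) = am (X i) := fun i hia hib => by simp [φ, v, hia, hib]
  have hφC : ∀ r : k, φ (C r) = am (C r) := by
    intro r
    rw [← MvPolynomial.algebraMap_eq, AlgHom.commutes]
    rfl
  -- the substitution `x_a ↦ x_a³x_b`, `x_b ↦ x_a²x_b` (`x_a = u³y`, `x_b = u²y`)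
  let w : Fin n → MvPolynomial (Fin n) k := fun i =>
    if i = a then X a ^ 3 * X b else if i = b then X a ^ 2 * X b else X i
  let θ : MvPolynomial (Fin n) k →ₐ[k] MvPolynomial (Fin n) k := aeval w
  have hθa : θ (X a) = X a ^ 3 * X b := by simp [θ, w]
  have hθb : θ (X b) = X a ^ 2 * X b := by simp [θ, w, hba]
  have hθi : ∀ i, i ≠ a → i ≠ b → θ (X i) = X i := fun i hia hib => by simp [θ, w, hia, hib]
  have hθC : ∀ r : k, θ (C r) = C r := fun r => by
    rw [← MvPolynomial.algebraMap_eq]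
    exact θ.commutes r
  -- chart ∘ substitution = localisation map
  have hφθ' : (φ : MvPolynomial (Fin n) k →+* L).comp (θ : MvPolynomial (Fin n) k →+* _) = am := by
    refine MvPolynomial.ringHom_ext (fun r => ?_) (fun i => ?_)
    · simp only [RingHom.coe_comp, RingHom.coe_coe, Function.comp_apply, hθC, hφC]
    · simp only [RingHom.coe_comp, RingHom.coe_coe, Function.comp_apply]
      by_cases hia : i = a
      · rw [hia, hθa, map_mul, map_pow, hφa, hφb]
        simp only [map_mul, map_pow]
        linear_combination (am (X a) * ((am (X a) ^ 3 * am (X b) * ι) ^ 3 +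
          (am (X a) ^ 3 * am (X b) * ι) ^ 2 + am (X a) ^ 3 * am (X b) * ι + 1)) * hinv
      · by_cases hib : i = b
        · rw [hib, hθb, map_mul, map_pow, hφa, hφb]
          simp only [map_mul, map_pow]
          linear_combination (am (X b) * ((am (X a) ^ 3 * am (X b) * ι) ^ 2 +
            am (X a) ^ 3 * am (X b) * ι + 1)) * hinv
        · rw [hθi i hia hib, hφi i hia hib]
  have hφθ : ∀ r, φ (θ r) = am r := fun r => RingHom.congr_fun hφθ' r
  -- injectivity: the substitution extends to `R[1/x_a³x_b]` and retracts the chart map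
  have hunita : IsUnit (am (X a)) :=
    IsUnit.of_mul_eq_one (am (X a) ^ 2 * am (X b) * ι) (by linear_combination hinv)
  have hunitb : IsUnit (am (X b)) :=
    IsUnit.of_mul_eq_one (am (X a) ^ 3 * ι) (by linear_combination hinv)
  have hunit : IsUnit ((am.comp (θ : MvPolynomial (Fin n) k →+* _)) (c 1)) := by
    change IsUnit (am (θ (X a ^ 3 * X b)))
    rw [map_mul, map_pow, hθa, hθb]
    simp only [map_mul, map_pow]
    exact (((hunita.pow 3).mul hunitb).pow 3).mul ((hunita.pow 2).mul hunitb)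
  let Θ : L →+* L := IsLocalization.Away.lift (c 1) hunit
  have hΘam : ∀ r, Θ (am r) = am (θ r) := fun r => IsLocalization.Away.lift_eq (c 1) hunit r
  have hΘι : am (X a) ^ 11 * am (X b) ^ 4 * Θ ι = 1 := by
    have h : Θ (am (c 1) * ι) = 1 := by rw [Away.mul_invSelf, map_one]
    rw [map_mul, hΘam] at h
    change am (θ (X a ^ 3 * X b)) * Θ ι = 1 at h
    rw [map_mul, map_pow, hθa, hθb] at h
    simp only [map_mul, map_pow] at h
    linear_combination h
  have hΘφ' : Θ.comp (φ : MvPolynomial (Fin n) k →+* L) = am := by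
    refine MvPolynomial.ringHom_ext (fun r => ?_) (fun i => ?_)
    · simp only [RingHom.coe_comp, RingHom.coe_coe, Function.comp_apply, hφC, hΘam, hθC]
    · simp only [RingHom.coe_comp, RingHom.coe_coe, Function.comp_apply]
      by_cases hia : i = a
      · rw [hia, hφa, map_mul, hΘam]
        simp only [map_pow, hθa, map_mul]
        linear_combination (am (X a)) * hΘι
      · by_cases hib : i = b
        · rw [hib, hφb, map_mul, hΘam]
          simp only [map_mul, map_pow, hθa, hθb]
          linear_combination (am (X b)) * hΘι
        · rw [hφi i hia hib, hΘam, hθi i hia hib]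
  have hΘφ : ∀ r, Θ (φ r) = am r := fun r => RingHom.congr_fun hΘφ' r
  have hinj : Function.Injective (φ : MvPolynomial (Fin n) k →+* L) := by
    intro p q hpq
    apply algebraMap_away_injective k n (c 1)
      (mul_ne_zero (pow_ne_zero 3 (X_ne_zero a)) (X_ne_zero b))
    change am p = am q
    rw [← hΘφ p, ← hΘφ q]
    exact congrArg Θ hpq
  -- values in the blowup algebra
  have hmem : ∀ p, (φ : MvPolynomial (Fin n) k →+* L) p ∈
      blowupAlgebra (Ideal.span (Set.range c)) (c 1) := by
    intro p
    induction p using MvPolynomial.induction_on with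
    | C r =>
      rw [RingHom.coe_coe, hφC]
      exact Subalgebra.algebraMap_mem _ _
    | add p q hp hq =>
      rw [map_add]
      exact Subalgebra.add_mem _ hp hq
    | mul_X p i hp =>
      rw [map_mul]
      refine Subalgebra.mul_mem _ hp ?_
      by_cases hia : i = a
      · rw [hia, RingHom.coe_coe, hφa]
        exact div_mem_blowupAlgebra _ _ (Ideal.subset_span ⟨0, rfl⟩)
      · by_cases hib : i = b
        · rw [hib, RingHom.coe_coe, hφb]
          exact div_mem_blowupAlgebra _ _ (Ideal.subset_span ⟨3, rfl⟩)
        · rw [RingHom.coe_coe, hφi i hia hib]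
          exact Subalgebra.algebraMap_mem _ _
  -- the generators `c_i / x_a³x_b` are values of the chart map
  have hgen : ∀ i : Fin 5, am (c i) * ι ∈ Set.range (φ : MvPolynomial (Fin n) k →+* L) := by
    intro i
    fin_cases i
    · exact ⟨X a, by rw [RingHom.coe_coe, hφa]; rfl⟩
    · exact ⟨1, by rw [map_one]; exact (Away.mul_invSelf (S := L) (c 1)).symm⟩
    · refine ⟨X a * X b, ?_⟩
      rw [RingHom.coe_coe, map_mul, hφa, hφb]
      change _ = am (X a ^ 2 * X b ^ 3) * ι
      simp only [map_mul, map_pow]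
      linear_combination (am (X a) ^ 2 * am (X b) ^ 3 * ι) * hinv
    · exact ⟨X b, by rw [RingHom.coe_coe, hφb]; rfl⟩
    · refine ⟨X a * X b ^ 2, ?_⟩
      rw [RingHom.coe_coe, map_mul, map_pow, hφa, hφb]
      change _ = am (X b ^ 6) * ι
      simp only [map_mul, map_pow]
      linear_combination (am (X b) ^ 6 * ι * (am (X a) ^ 3 * am (X b) * ι + 1)) * hinv
  have hrange := range_eq_blowupAlgebra_of_chart c 1 (φ : MvPolynomial (Fin n) k →+* L) hmem
    (fun r => ⟨θ r, hφθ r⟩) hgen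
  exact isRegularRing_chartRing_of_chart c 1 (φ : MvPolynomial (Fin n) k →+* L) hinj hrange

end Charts

end Summit.ResolutionOfSingularities.ResolutionOfSingularities.Theorems.WildQuotientResolution.JordanThree

end
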